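import Summits.SmoothPoincare4.SmoothPoincare4.Theses.EinsteinBulk

/-!
# Crux `EinsteinBulk.PEFillNearRound` (item stmt-SmoothPoincare4-7997) — birth skeleton
# `standard-or-thin`: PE-FILL(δ) ⇐ PE-FILL(δ) on the STANDARD sphere ∧ the uniform Yamabe GAP for exotica

Filed by the crux-strategist of `InformationMetricHadamard.AhHadamardFilling` (stmt-SmoothPoincare4-6014,
BC2 redirect: PE-FILL is piece X₂ of the route-level split of that crux) as the PLAN for this open piece.

The observation behind the cut. `PEFillNearRound` quantifies over ALL closed smooth `M ≃ₕ S⁴`. Split the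
domain by the (undecided) diffeomorphism type of `M`:

* `M ≅ S⁴` (standard): PE-FILL(δ) is a statement of GEOMETRIC ANALYSIS on the 5-ball — large-data
  existence of Poincaré–Einstein fillings of Yamabe-near-round conformal classes on `S⁴`
  (`stub_peFillStandard`; tools: Graham–Lee 1991 / Lee 2006 Thm A openness at `K ≤ 0` fillings,
  Li–Qing–Shi 2017 pinching ⇒ compactness of near-round fillings, Anderson's degree theory,
  Chruściel–Delay–Lee–Skinner boundary regularity; open, but S⁴-internal and refutable on dumbbells).
* `M` exotic: a near-round class on an exotic `M` that WERE PE-filled would be pinched (Li–Qing–Shi,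
  item 7996) and recognised (`EinsteinHadamardFillingStandard`, item 7999, GGSU at C²) — contradiction.
  So on exotica PE-FILL(δ) can only hold VACUOUSLY, i.e. it asserts the uniform Yamabe GAP
  `stub_exoticYamabeGap`: every homotopy 4-sphere not diffeomorphic to `S⁴` is δ-Yamabe-thin
  (the GAP half of card `yamabe-extremal-or-thin`; vacuous under SPC4; `Y1 ∧ GAP ⇒ SPC4` by pure logic).

Hence `PEFillNearRound ⇐ stub_peFillStandard ∧ stub_exoticYamabeGap` (this file, `PEFillNearRound_of`,
by cases on `Nonempty (M ≃ₘ S⁴)`), and conversely `PEFillNearRound ∧ 7996 ∧ 7999 ⇒ GAP`. Recorded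
consequence for route bookkeeping (see the strategist's STRATEGY-CENSUS on stmt-6014): the Einstein
analysis of route `EinsteinBulk` is confined to the standard sphere; its SPC4 content is `Y1 ∧ GAP`.
-/

noncomputable section

-- the prescribed namespace `Summit.<P>.<Sub>.…` duplicates `SmoothPoincare4` (P = Sub)
set_option linter.dupNamespace false

open scoped Manifold ContDiff Topology ContinuousMap
open Set Function
open Literature.Geometry.Lorentzian
open Summit.SmoothPoincare4.SmoothPoincare4.Theses

namespace Summit.SmoothPoincare4.SmoothPoincare4.Cruxes.PEFillNearRound.StandardOrThin

/-- **Stub 1 — PE-FILL(δ) on the standard smooth 4-sphere.** There is `δ > 0` such that on every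
closed smooth 4-manifold DIFFEOMORPHIC to `S⁴`, every metric `g₀` with `Y(M,[g₀]) ≥ (1−δ)·8√6π`
(metric form: `(1−δ)·8√6π·√Vol(h) ≤ ∫ R_h` for all `h` conformal to `g₀`) is the conformal infinity of a
conformally compact Einstein 5-manifold (`Ric = −4g`, `C²` compactification, `|dρ|_ḡ = 1` on the
boundary). Why plausibly true: continuity method on `B⁵` from the hyperbolic filling of the round class —
openness at non-positively curved fillings (Lee 2006 Thm A), closedness from Li–Qing–Shi pinching +
Cheeger–Gromov compactness of Einstein AH metrics with controlled conformal infinity (Anderson 2008),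
provided the near-round Yamabe region is path connected to the round class; no obstruction is known in
bulk dimension 5 (Gursky–Han 2017 / Gursky–Han–Stolz 2021 need bulk dimension 4k). Why it might fail:
a dumbbell class `S⁴ #_neck S⁴` with `Y ↑ Y(S⁴)` bounding no PE manifold of any topology.
[cite: GrahamLee1991] [cite: Lee2006, Thm A] [cite: Anderson2008] [cite: LiQingShi2017, Thm 1.8] -/
theorem stub_peFillStandard :
    ∃ δ : ℝ, 0 < δ ∧ ∀ (M : Type) [TopologicalSpace M] [T2Space M] [SecondCountableTopology M]
      [ChartedSpace (EuclideanSpace ℝ (Fin 4)) M] [IsManifold (𝓡 4) ∞ M] [CompactSpace M]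
      [ConnectedSpace M] [MeasurableSpace M] [BorelSpace M],
      Nonempty (M ≃ₘ⟮𝓡 4, 𝓡 4⟯ Metric.sphere (0 : EuclideanSpace ℝ (Fin 5)) 1) →
      ∀ (g₀ : Bundle.ContMDiffRiemannianMetric (𝓡 4) ∞ (EuclideanSpace ℝ (Fin 4))
        (TangentSpace (𝓡 4) : M → Type _)),
      (∀ (h' : Bundle.ContMDiffRiemannianMetric (𝓡 4) ∞ (EuclideanSpace ℝ (Fin 4))
          (TangentSpace (𝓡 4) : M → Type _)) [(PseudoRiemannianMetric.ofRiemannian h').HasLeviCivita],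
        (∃ φ : M → ℝ, ∀ x : M, 0 < φ x ∧ ∀ v w : TangentSpace (𝓡 4) x,
            h'.inner x v w = φ x * g₀.inner x v w) →
          (1 - δ) * (8 * Real.sqrt 6 * Real.pi) *
              Real.sqrt ((riemannianMeasure h' Set.univ).toReal) ≤
            ∫ x, (PseudoRiemannianMetric.ofRiemannian h').scalarCurvature x ∂(riemannianMeasure h')) →
      ∃ (N : Type) (_ : TopologicalSpace N) (_ : T2Space N) (_ : SecondCountableTopology N)
        (_ : ChartedSpace (EuclideanSpace ℝ (Fin 5)) N) (_ : IsManifold (𝓡 5) ∞ N)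
        (g : Bundle.ContMDiffRiemannianMetric (𝓡 5) ∞ (EuclideanSpace ℝ (Fin 5))
          (TangentSpace (𝓡 5) : N → Type _))
        (_ : (PseudoRiemannianMetric.ofRiemannian g).HasLeviCivita),
        (∀ x, (PseudoRiemannianMetric.ofRiemannian g).ricci x =
            (-4 : ℝ) • (PseudoRiemannianMetric.ofRiemannian g).toBilinForm x) ∧
        (∃ (X : Type) (_ : TopologicalSpace X) (_ : T2Space X) (_ : SecondCountableTopology X)
          (_ : ChartedSpace (EuclideanHalfSpace 5) X) (_ : IsManifold (𝓡∂ 5) ∞ X) (_ : CompactSpace X)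
          (_ : ConnectedSpace X) (j : N → X) (ι : M → X) (ρ : X → ℝ)
          (gb : Bundle.ContMDiffRiemannianMetric (𝓡∂ 5) 2 (EuclideanSpace ℝ (Fin 5))
            (TangentSpace (𝓡∂ 5) : X → Type _)),
          Manifold.IsSmoothEmbedding (𝓡 5) (𝓡∂ 5) ∞ j ∧ Set.range j = (𝓡∂ 5).interior X ∧
          Manifold.IsSmoothEmbedding (𝓡 4) (𝓡∂ 5) ∞ ι ∧ Set.range ι = (𝓡∂ 5).boundary X ∧
          ContMDiff (𝓡∂ 5) 𝓘(ℝ, ℝ) ∞ ρ ∧ (∀ x : X, 0 ≤ ρ x) ∧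
          (∀ x : X, ρ x = 0 ↔ x ∈ (𝓡∂ 5).boundary X) ∧
          (∀ y : M, ∃ ν : TangentSpace (𝓡∂ 5) (ι y), gb.inner (ι y) ν ν = 1 ∧
            ∀ v : TangentSpace (𝓡∂ 5) (ι y), gb.inner (ι y) ν v = mfderiv (𝓡∂ 5) 𝓘(ℝ, ℝ) ρ (ι y) v) ∧
          (∀ (x : N) (v w : TangentSpace (𝓡 5) x),
            gb.inner (j x) (mfderiv (𝓡 5) (𝓡∂ 5) j x v) (mfderiv (𝓡 5) (𝓡∂ 5) j x w) =
              ρ (j x) ^ 2 * g.inner x v w) ∧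
          (∃ φ : M → ℝ, ∀ y : M, 0 < φ y ∧ ∀ v w : TangentSpace (𝓡 4) y,
            gb.inner (ι y) (mfderiv (𝓡 4) (𝓡∂ 5) ι y v) (mfderiv (𝓡 4) (𝓡∂ 5) ι y w) =
              φ y * g₀.inner y v w)) := by
  sorry

/-- **Stub 2 — the uniform Yamabe GAP for exotica, GAP(δ).** There is `δ > 0` such that a closed
smooth 4-manifold homotopy equivalent but NOT diffeomorphic to `S⁴` carries NO metric `g₀` with
`Y(M,[g₀]) ≥ (1−δ)·8√6π` (metric form): exotic 4-spheres are uniformly Yamabe-thin,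
`sup {σ(Σ) : Σ exotic} < σ(S⁴)`. Vacuous under SPC4; `Y1 ∧ GAP ⇒ SPC4`; the GAP half of card
`yamabe-extremal-or-thin` (a removable-singularity / bubble-tree statement for Yamabe metrics with
`s_i ↑ σ₄` on simply connected 4-manifolds). Why it might fail: an exotic sphere with `σ = σ₄`
unattained (ever-rounder degenerating Yamabe metrics), or exotic spheres with `σ → σ₄`.
[cite: Schoen1989] [cite: Kobayashi1987] [cite: AmmannDahlHumbert2013] -/
theorem stub_exoticYamabeGap :
    ∃ δ : ℝ, 0 < δ ∧ ∀ (M : Type) [TopologicalSpace M] [T2Space M] [SecondCountableTopology M]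
      [ChartedSpace (EuclideanSpace ℝ (Fin 4)) M] [IsManifold (𝓡 4) ∞ M] [CompactSpace M]
      [ConnectedSpace M] [MeasurableSpace M] [BorelSpace M],
      M ≃ₕ Metric.sphere (0 : EuclideanSpace ℝ (Fin 5)) 1 →
      ¬ Nonempty (M ≃ₘ⟮𝓡 4, 𝓡 4⟯ Metric.sphere (0 : EuclideanSpace ℝ (Fin 5)) 1) →
      ∀ (g₀ : Bundle.ContMDiffRiemannianMetric (𝓡 4) ∞ (EuclideanSpace ℝ (Fin 4))
        (TangentSpace (𝓡 4) : M → Type _)),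
      ¬ (∀ (h' : Bundle.ContMDiffRiemannianMetric (𝓡 4) ∞ (EuclideanSpace ℝ (Fin 4))
          (TangentSpace (𝓡 4) : M → Type _)) [(PseudoRiemannianMetric.ofRiemannian h').HasLeviCivita],
        (∃ φ : M → ℝ, ∀ x : M, 0 < φ x ∧ ∀ v w : TangentSpace (𝓡 4) x,
            h'.inner x v w = φ x * g₀.inner x v w) →
          (1 - δ) * (8 * Real.sqrt 6 * Real.pi) *
              Real.sqrt ((riemannianMeasure h' Set.univ).toReal) ≤
            ∫ x, (PseudoRiemannianMetric.ofRiemannian h').scalarCurvature x ∂(riemannianMeasure h')) := by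
  sorry

/-- **THE SKELETON THEOREM: PE-FILL(δ) BY NAME from the two registered stubs** (no hypotheses; sorries
only inside `stub_*`), by cases on the diffeomorphism type of `M` (classical): `δ := min δ₁ δ₂`; a
standard `M` is filled by stub 1, an exotic `M` has no near-round class by stub 2, so the hypothesis is
contradictory there. -/
theorem PEFillNearRound_of : EinsteinBulk.PEFillNearRound := by
  obtain ⟨δ₁, hδ₁, H1⟩ := stub_peFillStandard
  obtain ⟨δ₂, hδ₂, H2⟩ := stub_exoticYamabeGap
  refine ⟨min δ₁ δ₂, lt_min hδ₁ hδ₂, ?_⟩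
  intro M _ _ _ _ _ _ _ _ _ he g₀ hY
  have mono : ∀ {δ C V I : ℝ}, min δ₁ δ₂ ≤ δ → 0 ≤ C → 0 ≤ V →
      (1 - min δ₁ δ₂) * C * V ≤ I → (1 - δ) * C * V ≤ I := by
    intro δ C V I hδ hC hV h
    exact (mul_le_mul_of_nonneg_right
      (mul_le_mul_of_nonneg_right (sub_le_sub_left hδ 1) hC) hV).trans h
  by_cases hstd : Nonempty (M ≃ₘ⟮𝓡 4, 𝓡 4⟯ Metric.sphere (0 : EuclideanSpace ℝ (Fin 5)) 1)
  · exact H1 M hstd g₀ (by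
      intro h' _ hconf
      exact mono (min_le_left _ _) (by positivity) (Real.sqrt_nonneg _) (hY h' hconf))
  · exfalso
    refine H2 M he hstd g₀ ?_
    intro h' _ hconf
    exact mono (min_le_right _ _) (by positivity) (Real.sqrt_nonneg _) (hY h' hconf)

/-! ## The typed implication `Stub₁ → Stub₂ → PEFillNearRound` (documentation of the cut; the statements
as propositions) -/

/-- Statement of `stub_peFillStandard`. -/
def PeFillStandardStmt : Prop :=
    ∃ δ : ℝ, 0 < δ ∧ ∀ (M : Type) [TopologicalSpace M] [T2Space M] [SecondCountableTopology M]
      [ChartedSpace (EuclideanSpace ℝ (Fin 4)) M] [IsManifold (𝓡 4) ∞ M] [CompactSpace M]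
      [ConnectedSpace M] [MeasurableSpace M] [BorelSpace M],
      Nonempty (M ≃ₘ⟮𝓡 4, 𝓡 4⟯ Metric.sphere (0 : EuclideanSpace ℝ (Fin 5)) 1) →
      ∀ (g₀ : Bundle.ContMDiffRiemannianMetric (𝓡 4) ∞ (EuclideanSpace ℝ (Fin 4))
        (TangentSpace (𝓡 4) : M → Type _)),
      (∀ (h' : Bundle.ContMDiffRiemannianMetric (𝓡 4) ∞ (EuclideanSpace ℝ (Fin 4))
          (TangentSpace (𝓡 4) : M → Type _)) [(PseudoRiemannianMetric.ofRiemannian h').HasLeviCivita],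
        (∃ φ : M → ℝ, ∀ x : M, 0 < φ x ∧ ∀ v w : TangentSpace (𝓡 4) x,
            h'.inner x v w = φ x * g₀.inner x v w) →
          (1 - δ) * (8 * Real.sqrt 6 * Real.pi) *
              Real.sqrt ((riemannianMeasure h' Set.univ).toReal) ≤
            ∫ x, (PseudoRiemannianMetric.ofRiemannian h').scalarCurvature x ∂(riemannianMeasure h')) →
      ∃ (N : Type) (_ : TopologicalSpace N) (_ : T2Space N) (_ : SecondCountableTopology N)
        (_ : ChartedSpace (EuclideanSpace ℝ (Fin 5)) N) (_ : IsManifold (𝓡 5) ∞ N)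
        (g : Bundle.ContMDiffRiemannianMetric (𝓡 5) ∞ (EuclideanSpace ℝ (Fin 5))
          (TangentSpace (𝓡 5) : N → Type _))
        (_ : (PseudoRiemannianMetric.ofRiemannian g).HasLeviCivita),
        (∀ x, (PseudoRiemannianMetric.ofRiemannian g).ricci x =
            (-4 : ℝ) • (PseudoRiemannianMetric.ofRiemannian g).toBilinForm x) ∧
        (∃ (X : Type) (_ : TopologicalSpace X) (_ : T2Space X) (_ : SecondCountableTopology X)
          (_ : ChartedSpace (EuclideanHalfSpace 5) X) (_ : IsManifold (𝓡∂ 5) ∞ X) (_ : CompactSpace X)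
          (_ : ConnectedSpace X) (j : N → X) (ι : M → X) (ρ : X → ℝ)
          (gb : Bundle.ContMDiffRiemannianMetric (𝓡∂ 5) 2 (EuclideanSpace ℝ (Fin 5))
            (TangentSpace (𝓡∂ 5) : X → Type _)),
          Manifold.IsSmoothEmbedding (𝓡 5) (𝓡∂ 5) ∞ j ∧ Set.range j = (𝓡∂ 5).interior X ∧
          Manifold.IsSmoothEmbedding (𝓡 4) (𝓡∂ 5) ∞ ι ∧ Set.range ι = (𝓡∂ 5).boundary X ∧
          ContMDiff (𝓡∂ 5) 𝓘(ℝ, ℝ) ∞ ρ ∧ (∀ x : X, 0 ≤ ρ x) ∧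
          (∀ x : X, ρ x = 0 ↔ x ∈ (𝓡∂ 5).boundary X) ∧
          (∀ y : M, ∃ ν : TangentSpace (𝓡∂ 5) (ι y), gb.inner (ι y) ν ν = 1 ∧
            ∀ v : TangentSpace (𝓡∂ 5) (ι y), gb.inner (ι y) ν v = mfderiv (𝓡∂ 5) 𝓘(ℝ, ℝ) ρ (ι y) v) ∧
          (∀ (x : N) (v w : TangentSpace (𝓡 5) x),
            gb.inner (j x) (mfderiv (𝓡 5) (𝓡∂ 5) j x v) (mfderiv (𝓡 5) (𝓡∂ 5) j x w) =
              ρ (j x) ^ 2 * g.inner x v w) ∧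
          (∃ φ : M → ℝ, ∀ y : M, 0 < φ y ∧ ∀ v w : TangentSpace (𝓡 4) y,
            gb.inner (ι y) (mfderiv (𝓡 4) (𝓡∂ 5) ι y v) (mfderiv (𝓡 4) (𝓡∂ 5) ι y w) =
              φ y * g₀.inner y v w))

/-- Statement of `stub_exoticYamabeGap`. -/
def ExoticYamabeGapStmt : Prop :=
    ∃ δ : ℝ, 0 < δ ∧ ∀ (M : Type) [TopologicalSpace M] [T2Space M] [SecondCountableTopology M]
      [ChartedSpace (EuclideanSpace ℝ (Fin 4)) M] [IsManifold (𝓡 4) ∞ M] [CompactSpace M]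
      [ConnectedSpace M] [MeasurableSpace M] [BorelSpace M],
      M ≃ₕ Metric.sphere (0 : EuclideanSpace ℝ (Fin 5)) 1 →
      ¬ Nonempty (M ≃ₘ⟮𝓡 4, 𝓡 4⟯ Metric.sphere (0 : EuclideanSpace ℝ (Fin 5)) 1) →
      ∀ (g₀ : Bundle.ContMDiffRiemannianMetric (𝓡 4) ∞ (EuclideanSpace ℝ (Fin 4))
        (TangentSpace (𝓡 4) : M → Type _)),
      ¬ (∀ (h' : Bundle.ContMDiffRiemannianMetric (𝓡 4) ∞ (EuclideanSpace ℝ (Fin 4))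
          (TangentSpace (𝓡 4) : M → Type _)) [(PseudoRiemannianMetric.ofRiemannian h').HasLeviCivita],
        (∃ φ : M → ℝ, ∀ x : M, 0 < φ x ∧ ∀ v w : TangentSpace (𝓡 4) x,
            h'.inner x v w = φ x * g₀.inner x v w) →
          (1 - δ) * (8 * Real.sqrt 6 * Real.pi) *
              Real.sqrt ((riemannianMeasure h' Set.univ).toReal) ≤
            ∫ x, (PseudoRiemannianMetric.ofRiemannian h').scalarCurvature x ∂(riemannianMeasure h'))

/-- The typed implication: `PeFillStandardStmt → ExoticYamabeGapStmt → PEFillNearRound` (same proof as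
`PEFillNearRound_of`, with the stubs as hypotheses). -/
theorem PEFillNearRound_of_stmts (h1 : PeFillStandardStmt) (h2 : ExoticYamabeGapStmt) :
    EinsteinBulk.PEFillNearRound := by
  obtain ⟨δ₁, hδ₁, H1⟩ := h1
  obtain ⟨δ₂, hδ₂, H2⟩ := h2
  refine ⟨min δ₁ δ₂, lt_min hδ₁ hδ₂, ?_⟩
  intro M _ _ _ _ _ _ _ _ _ he g₀ hY
  have mono : ∀ {δ C V I : ℝ}, min δ₁ δ₂ ≤ δ → 0 ≤ C → 0 ≤ V →
      (1 - min δ₁ δ₂) * C * V ≤ I → (1 - δ) * C * V ≤ I := by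
    intro δ C V I hδ hC hV h
    exact (mul_le_mul_of_nonneg_right
      (mul_le_mul_of_nonneg_right (sub_le_sub_left hδ 1) hC) hV).trans h
  by_cases hstd : Nonempty (M ≃ₘ⟮𝓡 4, 𝓡 4⟯ Metric.sphere (0 : EuclideanSpace ℝ (Fin 5)) 1)
  · exact H1 M hstd g₀ (by
      intro h' _ hconf
      exact mono (min_le_left _ _) (by positivity) (Real.sqrt_nonneg _) (hY h' hconf))
  · exfalso
    refine H2 M he hstd g₀ ?_
    intro h' _ hconf
    exact mono (min_le_right _ _) (by positivity) (Real.sqrt_nonneg _) (hY h' hconf)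

end Summit.SmoothPoincare4.SmoothPoincare4.Cruxes.PEFillNearRound.StandardOrThin

end
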